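import Summits.ABC.IUTFork.Cor312SoundInput
import Summits.ABC.IUTFork.Cor312MultiradTwist
import HarnessLib

/-!
# [IUTchIII] Cor. 3.12 — the gap statement of record absorbs the (Ind3) reindex

Record-only file (D-0012) of the abc-iut cell (D-0067 Cor. 3.12 strategy TEAM C «étale-picture /
multiradiality», seat abc-iut-c312-13, row C-9 of `HOME/plan/C312-TEAMS.md`); TAKES NO SIDE. Companion
of row C-8 (`Cor312SoundInputTwist.lean`), completing the orbit-canonicity of **GapA** = `SoundAtInput`
(A1, `Cor312SoundInput.lean`; GAP-LEDGER row G-c312-9-1) over the THIRD indeterminacy: re-indexing the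
lattice `m`-labels of the Kummer tower by any bijection `e : ℤ ≃ ℤ` — the "variation in `m`" of
Thm. 3.11 (ii) whose images enter Cor. 3.12 only through their union ((Ind3), kurims
`paper:url-4b091feeb646` p. 156: upper semi-compatibility) — changes the gap statement of record at NO
input (`reindexGlue_soundAtInput_iff`, no hypothesis: the union over `m ∈ ℤ` absorbs the re-indexing at
every object, `reindexGlue_thetaRegion3At`). With row C-8 (Θ-glue (Ind1)(Ind2) twist; column transport;
q-glue twist modulo Step (x) volume invariance) this closes the census: GapA is invariant under every
re-choice within (Ind1), (Ind2) AND (Ind3) and under the étale-picture column transport — the pairwise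
iffs compose (e.g. with `twistGlue_soundAtInput_iff` / `recolumn_soundAtInput_iff`, both generic in the
setting). Deliberately NOT here: any claim that `SoundAtInput` holds or fails for an instantiated
setting; any set-level (xi-f) content. Nothing here asserts Cor. 3.12.
[claim: Mochizuki2012, status: disputed] for the quoted clauses; all proofs are [folklore] bookkeeping
over rows C-1 and A-4.
-/

noncomputable section

namespace Summit.ABC

namespace IUTFork

namespace Cor312Vol

open Thm311 Cor312 Literature.IUT.LogThetaLattice

variable {T : ThetaIndex} {S : Situation T} (P : Cor312.Setting S) (e : ℤ ≃ ℤ)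

/-- The reindexed Θ-glue at an arbitrary input: the image at `m` is the original at `e m`
(definitional). [folklore] -/
theorem reindexGlue_thetaRegionOfAt (m : ℤ) (o : P.Ob P.sig.Clgp) (j : T.Label) (vQ : T.VQ) :
    (P.reindexGlue e).thetaRegionOf m o j vQ = P.thetaRegionOf (e m) o j vQ := rfl

/-- **(Ind3) ABSORPTION AT EVERY INPUT**: the (Ind3)-enlarged image of an arbitrary object is invariant
under any re-indexing of the Kummer tower (row C-1's `reindexGlue_thetaRegion3`, input free). [folklore] -/
theorem reindexGlue_thetaRegion3At (o : P.Ob P.sig.Clgp) (j : T.Label) (vQ : T.VQ) :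
    thetaRegion3At (P.reindexGlue e) o j vQ = thetaRegion3At P o j vQ := by
  show (⋃ m : ℤ, P.thetaRegionOf (e m) o j vQ) = ⋃ m : ℤ, P.thetaRegionOf m o j vQ
  refine Set.Subset.antisymm
    (Set.iUnion_subset fun m =>
      Set.subset_iUnion (fun m' : ℤ => P.thetaRegionOf m' o j vQ) (e m))
    (Set.iUnion_subset fun m => ?_)
  simpa using Set.subset_iUnion (fun m' : ℤ => P.thetaRegionOf (e m') o j vQ) (e.symm m)

/-- The reindexed setting has the same possible images of every object. [folklore] -/
theorem reindexGlue_possibleImagesAt (o : P.Ob P.sig.Clgp) (j : T.Label) (vQ : T.VQ) :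
    possibleImagesAt (P.reindexGlue e) o j vQ = possibleImagesAt P o j vQ := by
  unfold possibleImagesAt
  simp only [reindexGlue_thetaRegion3At]

/-- The packet hull of an arbitrary input is reindex-invariant. [folklore] -/
theorem reindexGlue_thetaHullAt (o : P.Ob P.sig.Clgp) (j : T.Label) (vQ : T.VQ) :
    thetaHullAt (P.reindexGlue e) o j vQ = thetaHullAt P o j vQ := by
  have hfr : (P.reindexGlue e).frame j vQ = P.frame j vQ := rfl
  unfold thetaHullAt
  rw [reindexGlue_possibleImagesAt P e o j vQ, hfr]

/-- Hull-definedness of an arbitrary input is reindex-invariant. [folklore] -/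
theorem reindexGlue_hullDefinedAt_iff (o : P.Ob P.sig.Clgp) (j : T.Label) (vQ : T.VQ) :
    HullDefinedAt (P.reindexGlue e) o j vQ ↔ HullDefinedAt P o j vQ := by
  have hfr : (P.reindexGlue e).frame j vQ = P.frame j vQ := rfl
  unfold HullDefinedAt
  rw [reindexGlue_possibleImagesAt P e o j vQ, hfr]

/-- The local hull volume of an arbitrary input is reindex-invariant. [folklore] -/
theorem reindexGlue_thetaLocalAt (o : P.Ob P.sig.Clgp) (j : T.Label) (vQ : T.VQ) :
    thetaLocalAt (P.reindexGlue e) o j vQ = thetaLocalAt P o j vQ := by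
  have hd := reindexGlue_hullDefinedAt_iff P e o j vQ
  have hh := reindexGlue_thetaHullAt P e o j vQ
  have hn : (P.reindexGlue e).n = P.n := rfl
  unfold thetaLocalAt
  by_cases h : HullDefinedAt P o j vQ
  · rw [if_pos h, if_pos (hd.mpr h), hh, hn]
  · rw [if_neg h, if_neg fun hc => h (hd.mp hc)]

/-- The finiteness clause of an arbitrary input is reindex-invariant. [folklore] -/
theorem reindexGlue_thetaFiniteAt_iff (o : P.Ob P.sig.Clgp) :
    ThetaFiniteAt (P.reindexGlue e) o ↔ ThetaFiniteAt P o := by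
  have hl : thetaLocalAt (P.reindexGlue e) o = thetaLocalAt P o :=
    funext fun j => funext fun vQ => reindexGlue_thetaLocalAt P e o j vQ
  unfold ThetaFiniteAt
  rw [hl]

/-- **The global hull volume of EVERY input absorbs the (Ind3) reindex** (row C-1's
`reindexGlue_negLogTheta`, input free). [folklore] -/
theorem reindexGlue_negLogThetaAt (o : P.Ob P.sig.Clgp) :
    negLogThetaAt (P.reindexGlue e) o = negLogThetaAt P o := by
  have hl : thetaLocalAt (P.reindexGlue e) o = thetaLocalAt P o :=
    funext fun j => funext fun vQ => reindexGlue_thetaLocalAt P e o j vQ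
  have hf := reindexGlue_thetaFiniteAt_iff P e o
  unfold negLogThetaAt
  by_cases h : ThetaFiniteAt P o
  · rw [if_pos h, if_pos (hf.mpr h), hl]
  · rw [if_neg h, if_neg fun hc => h (hf.mp hc)]

/-- The q-side volume of any input is untouched by the reindex (definitional). [folklore] -/
theorem reindexGlue_negLogQAt (o' : P.ObΔ) :
    negLogQAt (P.reindexGlue e) o' = negLogQAt P o' := rfl

/-- The Step (xi-a) gluing transports to the reindexed setting (object types and pilots untouched).
[folklore] -/
def LinkGluing.reindex (G : LinkGluing P) : LinkGluing (P.reindexGlue e) :=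
  ⟨G.linkMap, G.link_thetaPilot⟩

/-- The transported gluing has the same underlying map (definitional). [folklore] -/
theorem LinkGluing.reindex_linkMap (G : LinkGluing P) (o : P.Ob P.sig.Clgp) :
    (G.reindex P e).linkMap o = G.linkMap o := rfl

/-- **GapA ABSORBS THE (Ind3) REINDEX** (row C-9): re-indexing the Kummer tower changes the gap statement
of record at no input — no hypothesis. With row C-8's `twistGlue_soundAtInput_iff` /
`recolumn_soundAtInput_iff` / `qTwistGlue_soundAtInput_iff_of_invariance` this completes the census: the
isolated non-following inference of G-c312-9-1 is canonical under (Ind1), (Ind2), (Ind3) and the column.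
[folklore] -/
theorem reindexGlue_soundAtInput_iff (G : LinkGluing P) :
    SoundAtInput (P.reindexGlue e) (G.reindex P e) ↔ SoundAtInput P G := by
  unfold SoundAtInput
  refine forall_congr' fun o => ?_
  rw [reindexGlue_negLogThetaAt P e o, LinkGluing.reindex_linkMap P e G o,
    reindexGlue_negLogQAt P e (G.linkMap o)]

end Cor312Vol

end IUTFork

end Summit.ABC

end
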